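import Summits.BirchSwinnertonDyer.BirchSwinnertonDyer.Theorems.BiquadraticEisensteinDescentHeegnerTwistCouplingInSupplyRoundingPinCellData
import Summits.BirchSwinnertonDyer.BirchSwinnertonDyer.Theorems.BiquadraticEisensteinDescentHeegnerTwistCouplingInSupplySqrtTwoDualCorner
import HarnessLib

set_option linter.dupNamespace false -- `Summit.BirchSwinnertonDyer.BirchSwinnertonDyer.Theorems.…` (summit = sub)
set_option autoImplicit false

/-!
# Crux `HeegnerTwistCouplingInSupply` (stmt-BirchSwinnertonDyer-21381) — the `j = 8000` corner `W ∈ {B_p, B_{−2p}}`, `p ≡ 5 (mod 8)`: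
# ONE WINDOW RUNG «any `(5,−)`-partner `q₀` with `q₀² ≤ 9p`» in place of the thirteen fixed-partner rungs, and the rounding non-residue

Route `BiquadraticEisensteinDescent` (cell `pub/bsd-wall`, width seat `bsd-wall-cm-bed-w2` g13; `--supports` 21381, helper). The CELL-5 ladder
of the `j = 8000` corner (`…SqrtTwoLadder.cruxOnBpCornerPartner_of_two_facts`, w1 g10; dual member `…SqrtTwoDualCorner.cruxOnBdualCornerPartner_of_two_facts`)
takes a FIXED partner prime `q₀ ≡ 5 (mod 8)` with `(q₀/p) = −1` above a threshold `P(q₀) ≈ 2.2·q₀^{5/3}` (`8⁸q₀⁵ ≤ (2.718·3.1415)⁸P³`),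
because its class-number lever is linear (`|d| = ℓq₀ < q₀·p`, `ℓ < p` the `(3,−)` pin); thirteen rungs (`q₀ ≤ 197`) leave a structural
residual of density `2⁻¹³` (SQRT2-CORNER-w1g10 §3). With the `p^{3/2}`-lever of `…RoundingPinCellData` (`x ≤ B⁶·p·√p`, tangent of `log` at
`e²`) the partner may grow with `p`:

* §1 `inv_pi_mul_sqrt_mul_log_lt_of_sq_le` — `n² ≤ 9p³`, `p ≥ 2700` ⇒ `π⁻¹√n log n < p` (instance `B = 1.201`, `T = 7.2` of the lever), and
  `classNumber_lt_of_window` — `h(K) < p` for every imaginary quadratic `K` of discriminant `−ℓq₀` with `(ℓq₀)² ≤ 9p³`;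
* §2 ★ `cruxOnBpCornerWindow_of_two_facts` / ★ `cruxOnBdualCornerWindow_of_two_facts` — for every prime `p ≡ 5 (mod 8)`, `p ≥ 2700`, and
  EVERY prime `q₀ ≡ 5 (mod 8)` with `(q₀/p) = −1` and `q₀² ≤ 9p`: the crux conclusion for `W = B_p` resp. `W = B_{−2p}` (Heegner
  `K′ = ℚ(√−ℓq₀)`, `4 < |d|`, `L(W^{(d)}, 1) ≠ 0`, `h(K′) < p`, `p ∤ h(K′)`) modulo Burungale–Tian + Deuring–Hecke — the two rung proofs VERBATIM
  with the lever swapped; every fixed-partner rung is the special case `p ≥ max(P(q₀), q₀²/9)`;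
* §3 `roundingNonresidue` — for every prime `p ≡ 5 (mod 8)`, `p ≥ 13`: a prime `r ≡ ±3 (mod 8)` with `(r/p) = −1` and `r ≤ 4⌊√(p/2)⌋ + 3`
  (the even neighbours `w < √(p/2) < w + 2`: `p − 2w² ≡ 5`, `2(w+2)² − p ≡ 3 (mod 8)`, `(p/r) = (2w²/r) = (2/r) = −1`) — when `r ≡ 5 (mod 8)`
  it is a window partner (`r² ≤ 9p` for `p ≥ 400`), so the residual of the corner on `p ≡ 5 (mod 8)` reads: «`p ≥ 2700` with no
  `(5,−)`-partner below `3√p`» (least-prime-in-a-coset; heuristically empty, NOT claimed).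

HONEST FRAMING: typed sub-corner rungs on one CM family (`j = 8000`); the crux (all CM `W`; residual C⁺) is untouched; BSD is not proved by
any of this. THEOREMS ONLY (no definition, no new named fact, no `sorry`). Supports stmt-BirchSwinnertonDyer-21381.
-/

noncomputable section

open scoped Classical

namespace Summit.BirchSwinnertonDyer.BirchSwinnertonDyer.Theorems.BiquadraticEisensteinDescentHeegnerTwistCouplingInSupplySqrtTwoWindow

open _root_.WeierstrassCurve Literature.NumberTheory.EllipticCurves Literature.NumberTheory.EllipticCurves.HeathBrown1994.Families
open Literature.NumberTheory.QuadraticFields.Quadratic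
open Summit.BirchSwinnertonDyer.BirchSwinnertonDyer.Theorems.BiquadraticEisensteinDescentHeegnerTwistCouplingInSupplySqrtTwoCell
open Summit.BirchSwinnertonDyer.BirchSwinnertonDyer.Theorems.BiquadraticEisensteinDescentHeegnerTwistCouplingInSupplySqrtTwoCorner
open Summit.BirchSwinnertonDyer.BirchSwinnertonDyer.Theorems.BiquadraticEisensteinDescentHeegnerTwistCouplingInSupplySqrtTwoPin
open Summit.BirchSwinnertonDyer.BirchSwinnertonDyer.Theorems.BiquadraticEisensteinDescentHeegnerTwistCouplingInSupplySqrtTwoLadder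
open Summit.BirchSwinnertonDyer.BirchSwinnertonDyer.Theorems.BiquadraticEisensteinDescentHeegnerTwistCouplingInSupplySqrtTwoDual
open Summit.BirchSwinnertonDyer.BirchSwinnertonDyer.Theorems.BiquadraticEisensteinDescentHeegnerTwistCouplingInSupplySqrtTwoDualCorner
open Summit.BirchSwinnertonDyer.BirchSwinnertonDyer.Theorems.BiquadraticEisensteinDescentHeegnerTwistCouplingInSupplyPartnerLadder
open Summit.BirchSwinnertonDyer.BirchSwinnertonDyer.Theorems.BiquadraticEisensteinDescentHeegnerTwistCouplingInSupplySizeIndivisibleSharp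
  (classNumber_lt_of_sqrt_mul_log_lt)
open Summit.BirchSwinnertonDyer.BirchSwinnertonDyer.Theorems.BiquadraticEisensteinDescentHeegnerTwistCouplingInSupplyRoundingPin
  (exists_prime_dvd_mod_eight_three_or_five)
open Summit.BirchSwinnertonDyer.BirchSwinnertonDyer.Theorems.BiquadraticEisensteinDescentHeegnerTwistCouplingInSupplyRoundingPinCellData
  (inv_pi_mul_sqrt_mul_log_lt_of_le_pow_six)

/-! ## §1 The window lever: `(ℓq₀)² ≤ 9p³`, `p ≥ 2700` -/

/-- **Window lever.** For naturals `0 < n` and `p ≥ 2700` with `n² ≤ 9p³` (i.e. `n ≤ 3p^{3/2}`): `π⁻¹·√n·log n < p` (instance `B = 1.201`,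
`T = 7.2` of `inv_pi_mul_sqrt_mul_log_lt_of_le_pow_six`: `3 ≤ 1.201⁶`, `7.2⁴ ≤ 2700`, `6 < (3.14159/1.201⁴ − 0.8121)·1.201·7.2`). [folklore] -/
theorem inv_pi_mul_sqrt_mul_log_lt_of_sq_le {n p : ℕ} (hn : 0 < n) (hwin : n * n ≤ 9 * p ^ 3) (hp : 2700 ≤ p) :
    Real.pi⁻¹ * Real.sqrt n * Real.log n < p := by
  have hp' : (2700 : ℝ) ≤ p := by exact_mod_cast hp
  refine inv_pi_mul_sqrt_mul_log_lt_of_le_pow_six (B := 1.201) (T := 7.2) (by exact_mod_cast hn) (by norm_num) (by norm_num) ?_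
    (by norm_num) (le_trans (by norm_num) hp')
  set u : ℝ := Real.sqrt p with hu
  have hp0 : (0 : ℝ) ≤ p := by positivity
  have hu0 : 0 ≤ u := Real.sqrt_nonneg _
  have hu2 : u ^ 2 = p := Real.sq_sqrt hp0
  have hn0 : (0 : ℝ) ≤ n := by positivity
  have hwin' : (n : ℝ) * n ≤ 9 * (p : ℝ) ^ 3 := by exact_mod_cast hwin
  -- `n ≤ 3 p u` since `n² ≤ 9p³ = (3pu)²`
  have h3 : (n : ℝ) ≤ 3 * p * u := by
    have hsq : (n : ℝ) ^ 2 ≤ (3 * p * u) ^ 2 := by nlinarith [hu2]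
    exact le_of_pow_le_pow_left₀ (by norm_num) (by positivity) hsq
  calc (n : ℝ) ≤ 3 * p * u := h3
    _ ≤ (1.201 : ℝ) ^ 6 * p * u := by
        have : (3 : ℝ) ≤ (1.201 : ℝ) ^ 6 := by norm_num
        have hpu : 0 ≤ (p : ℝ) * u := by positivity
        nlinarith

/-- **`h(K) < p` in the window.** For primes `ℓ`, `q₀` with `q₀ ≡ 5 (mod 8)`, `(ℓq₀)² ≤ 9p³` and `p ≥ 2700`: every imaginary quadratic field of
discriminant `−ℓq₀` has class number `< p` (Oesterlé `h ≤ π⁻¹√|d| log|d|`, tree `classNumber_lt_of_sqrt_mul_log_lt`).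
[cite: Oesterle1988Gauss, II §3 Proposition p. 57 (27)] -/
theorem classNumber_lt_of_window {p l q₀ : ℕ} (hl : l.Prime) (hq₀ : q₀.Prime) (hq₀8 : q₀ % 8 = 5)
    (hwin : (l * q₀) * (l * q₀) ≤ 9 * p ^ 3) (hp : 2700 ≤ p) :
    ∀ (K : Type) [Field K] [NumberField K], IsImaginaryQuadratic K →
      NumberField.discr K = -((l * q₀ : ℕ) : ℤ) → NumberField.classNumber K < p := by
  intro K _ _ hK hdK
  have h4 : 4 < (NumberField.discr K).natAbs := by
    rw [hdK, Int.natAbs_neg, Int.natAbs_natCast]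
    have := hl.two_le
    have : 5 ≤ q₀ := by have := hq₀.two_le; omega
    nlinarith
  refine classNumber_lt_of_sqrt_mul_log_lt hK h4 ?_
  rw [hdK, Int.natAbs_neg, Int.natAbs_natCast]
  exact inv_pi_mul_sqrt_mul_log_lt_of_sq_le (Nat.mul_pos hl.pos hq₀.pos) hwin hp

/-- Window arithmetic: `ℓ < p` and `q₀² ≤ 9p` give `(ℓq₀)² ≤ 9p³`. [folklore] -/
theorem window_of_lt_of_sq_le {p l q₀ : ℕ} (hlp : l < p) (hq : q₀ * q₀ ≤ 9 * p) : (l * q₀) * (l * q₀) ≤ 9 * p ^ 3 := by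
  have hll : l * l ≤ p * p := Nat.mul_le_mul hlp.le hlp.le
  calc (l * q₀) * (l * q₀) = (l * l) * (q₀ * q₀) := by ring
    _ ≤ (p * p) * (9 * p) := Nat.mul_le_mul hll hq
    _ = 9 * p ^ 3 := by ring

/-! ## §2 ★ The window rungs for `W = B_p` and `W = B_{−2p}` -/

/-- ★ **WINDOW RUNG for `W = B_p`, two named facts.** For every prime `p ≡ 5 (mod 8)`, `p ≥ 2700`, and EVERY prime `q₀ ≡ 5 (mod 8)` with
`(q₀/p) = −1` and `q₀² ≤ 9p`: a Heegner field `K′ = ℚ(√−ℓq₀)` (`ℓ` the `(3,−)` pin, `ℓ < p`) of `N(B_p)` with `4 < |d_{K′}|`,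
`L(B_p^{(d_{K′})}, 1) ≠ 0` (CELL-5 at `m = pℓq₀`), `h(K′) < p` and `p ∤ h(K′)` — modulo Burungale–Tian + Deuring–Hecke. (Proof of
`cruxOnBpCornerPartner_of_two_facts` verbatim, lever `classNumber_lt_of_window`.) [cite: BurungaleTian2026, Thm. 1.1]
[cite: SilvermanAEC2009, Prop. X.4.9 and Thm. X.4.2(a)] [cite: Oesterle1988Gauss, II §3 Proposition p. 57 (27)] -/
theorem cruxOnBpCornerWindow_of_two_facts (hBT : burungaleTian_analyticRank_eq_zero_of_selmerCorank_eq_zero_of_hasCM)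
    (hH : hasEntireLFunction_of_j_mem_maximalCMJInvariants) :
    ∀ (p : ℕ) [Fact p.Prime] [(⟨0, 4 * (p : ℚ), 0, 2 * (p : ℚ) ^ 2, 0⟩ : WeierstrassCurve ℚ).IsElliptic]
      [(⟨0, 4 * (p : ℚ), 0, 2 * (p : ℚ) ^ 2, 0⟩ : WeierstrassCurve ℚ).IsGloballyMinimal]
      [NeZero ((⟨0, 4 * (p : ℚ), 0, 2 * (p : ℚ) ^ 2, 0⟩ : WeierstrassCurve ℚ).conductorNorm ℤ)],
      p % 8 = 5 → 2700 ≤ p → ∀ q₀ : ℕ, q₀.Prime → q₀ % 8 = 5 → jacobiSym (q₀ : ℤ) p = -1 → q₀ * q₀ ≤ 9 * p →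
      ∃ (K : Type) (_ : Field K) (_ : NumberField K),
        IsImaginaryQuadratic K ∧ 4 < (NumberField.discr K).natAbs ∧
        SatisfiesHeegnerHypothesis ((⟨0, 4 * (p : ℚ), 0, 2 * (p : ℚ) ^ 2, 0⟩ : WeierstrassCurve ℚ).conductorNorm ℤ) K ∧
        ((⟨0, 4 * (p : ℚ), 0, 2 * (p : ℚ) ^ 2, 0⟩ : WeierstrassCurve ℚ).quadraticTwist (NumberField.discr K : ℚ)).entireLFunction 1 ≠ 0 ∧
        NumberField.classNumber K < p ∧ ¬ p ∣ NumberField.classNumber K := by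
  intro p hpF _ _ _ hp8 hp2700 q₀ hq₀ hq₀8 hJq hwin
  have hp : p.Prime := hpF.out
  obtain ⟨ℓ, hℓ, hℓp, hℓ8, hJℓ⟩ := pinThreeMinus_of_mod_eight_eq_five p hp hp8
  have hJ : jacobiSym (-((ℓ * q₀ : ℕ) : ℤ)) p = 1 := jacobiSym_neg_mul_eq_one_of_mod_four_eq_one (by omega) hJℓ hJq
  obtain ⟨K, iF, iN, hK, hdK, hH', hcl⟩ := exists_witnessField_of
    (N := (⟨0, 4 * (p : ℚ), 0, 2 * (p : ℚ) ^ 2, 0⟩ : WeierstrassCurve ℚ).conductorNorm ℤ) hℓ hℓ8 hq₀ hq₀8 hJ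
    (classNumber_lt_of_window hℓ hq₀ hq₀8 (window_of_lt_of_sq_le hℓp hwin) hp2700)
    (fun r hr hrN => eq_two_or_eq_of_prime_dvd_conductorNorm_B hp hr hrN)
  refine ⟨K, iF, iN, hK, ?_, hH', ?_, hcl, fun hdvd =>
    absurd (Nat.le_of_dvd (NumberField.classNumber_pos K) hdvd) (not_le.mpr hcl)⟩
  · rw [hdK, Int.natAbs_neg, Int.natAbs_natCast]
    have h3 : 3 ≤ ℓ := by have := hℓ.two_le; omega
    have h5 : 5 ≤ q₀ := by have := hq₀.two_le; omega
    nlinarith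
  · rw [hdK, quadraticTwist_B_neg_mul]
    have hℓq : ℓ ≠ q₀ := by rintro rfl; omega
    obtain ⟨hsq, hfac⟩ := squarefree_mul_mul_of_primes hp hℓ hq₀ (by omega) (ne_of_jacobiSym_eq_neg_one hp hJq).symm hℓq
    have hm0 : (0 : ℤ) < ((p * ℓ * q₀ : ℕ) : ℤ) := by
      have := hp.pos
      have := hℓ.pos
      have := hq₀.pos
      positivity
    have hm8 : ∀ r : ℕ, r.Prime → (r : ℤ) ∣ ((p * ℓ * q₀ : ℕ) : ℤ) → r % 8 = 3 ∨ r % 8 = 5 := by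
      intro r hr hrd
      rcases hfac r hr (by exact_mod_cast hrd) with rfl | rfl | rfl <;> omega
    haveI := isElliptic_B hm0.ne'
    exact (L_one_ne_zero_B_neg hBT hH hm0 (Int.squarefree_natCast.mpr hsq) hm8).2

/-- ★ **WINDOW RUNG for the isogenous member `W = B_{−2p}`, two named facts**: same hypotheses and conclusion as
`cruxOnBpCornerWindow_of_two_facts` for `B_{−2p} = ⟨0, −8p, 0, 8p², 0⟩` (proof of `cruxOnBdualCornerPartner_of_two_facts` verbatim, lever
`classNumber_lt_of_window`). [cite: BurungaleTian2026, Thm. 1.1] [cite: Oesterle1988Gauss, II §3 Proposition p. 57 (27)] -/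
theorem cruxOnBdualCornerWindow_of_two_facts (hBT : burungaleTian_analyticRank_eq_zero_of_selmerCorank_eq_zero_of_hasCM)
    (hH : hasEntireLFunction_of_j_mem_maximalCMJInvariants) :
    ∀ (p : ℕ) [Fact p.Prime] [(⟨0, -8 * (p : ℚ), 0, 8 * (p : ℚ) ^ 2, 0⟩ : WeierstrassCurve ℚ).IsElliptic]
      [(⟨0, -8 * (p : ℚ), 0, 8 * (p : ℚ) ^ 2, 0⟩ : WeierstrassCurve ℚ).IsGloballyMinimal]
      [NeZero ((⟨0, -8 * (p : ℚ), 0, 8 * (p : ℚ) ^ 2, 0⟩ : WeierstrassCurve ℚ).conductorNorm ℤ)],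
      p % 8 = 5 → 2700 ≤ p → ∀ q₀ : ℕ, q₀.Prime → q₀ % 8 = 5 → jacobiSym (q₀ : ℤ) p = -1 → q₀ * q₀ ≤ 9 * p →
      ∃ (K : Type) (_ : Field K) (_ : NumberField K),
        IsImaginaryQuadratic K ∧ 4 < (NumberField.discr K).natAbs ∧
        SatisfiesHeegnerHypothesis ((⟨0, -8 * (p : ℚ), 0, 8 * (p : ℚ) ^ 2, 0⟩ : WeierstrassCurve ℚ).conductorNorm ℤ) K ∧
        ((⟨0, -8 * (p : ℚ), 0, 8 * (p : ℚ) ^ 2, 0⟩ : WeierstrassCurve ℚ).quadraticTwist (NumberField.discr K : ℚ)).entireLFunction 1 ≠ 0 ∧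
        NumberField.classNumber K < p ∧ ¬ p ∣ NumberField.classNumber K := by
  intro p hpF _ _ _ hp8 hp2700 q₀ hq₀ hq₀8 hJq hwin
  have hp : p.Prime := hpF.out
  obtain ⟨ℓ, hℓ, hℓp, hℓ8, hJℓ⟩ := pinThreeMinus_of_mod_eight_eq_five p hp hp8
  have hJ : jacobiSym (-((ℓ * q₀ : ℕ) : ℤ)) p = 1 := jacobiSym_neg_mul_eq_one_of_mod_four_eq_one (by omega) hJℓ hJq
  obtain ⟨K, iF, iN, hK, hdK, hH', hcl⟩ := exists_witnessField_of
    (N := (⟨0, -8 * (p : ℚ), 0, 8 * (p : ℚ) ^ 2, 0⟩ : WeierstrassCurve ℚ).conductorNorm ℤ) hℓ hℓ8 hq₀ hq₀8 hJ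
    (classNumber_lt_of_window hℓ hq₀ hq₀8 (window_of_lt_of_sq_le hℓp hwin) hp2700)
    (fun r hr hrN => eq_two_or_eq_of_prime_dvd_conductorNorm_Bdual hp hr hrN)
  refine ⟨K, iF, iN, hK, ?_, hH', ?_, hcl, fun hdvd =>
    absurd (Nat.le_of_dvd (NumberField.classNumber_pos K) hdvd) (not_le.mpr hcl)⟩
  · rw [hdK, Int.natAbs_neg, Int.natAbs_natCast]
    have h3 : 3 ≤ ℓ := by have := hℓ.two_le; omega
    have h5 : 5 ≤ q₀ := by have := hq₀.two_le; omega
    nlinarith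
  · rw [hdK, quadraticTwist_Bdual_neg_mul]
    exact L_one_ne_zero_dual_of_primes hBT hH hp hℓ hq₀ (by omega) (ne_of_jacobiSym_eq_neg_one hp hJq).symm
      (by rintro rfl; omega) (Or.inr hp8) (Or.inl hℓ8) (Or.inr hq₀8)

/-! ## §3 The rounding non-residue on `p ≡ 5 (mod 8)` -/

/-- **`(r/p) = −1` for a prime factor `r ≡ ±3 (mod 8)` of `|p − 2w²|`**, `p ≡ 1 (mod 4)` prime, `0 < w < p`: `2w² ≡ p (mod r)`, `r ∤ w`
(else `r ∣ p`, `r = p ∣ w`), so `(p/r) = (2/r)(w²/r) = −1`, and `(r/p) = (p/r)` (`p ≡ 1 (mod 4)`). [folklore] -/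
theorem jacobiSym_eq_neg_one_of_dvd_sub_two_mul_sq {p r w M : ℕ} (hp : p.Prime) (hp4 : p % 4 = 1) (hr : r.Prime)
    (hr8 : r % 8 = 3 ∨ r % 8 = 5) (hM : 2 * (w * w) + M = p ∨ p + M = 2 * (w * w)) (hrM : r ∣ M) (hw0 : 0 < w) (hwp : w < p) :
    jacobiSym (r : ℤ) p = -1 := by
  -- `r ∤ w`
  have hrw : ¬ r ∣ w := by
    intro hrw
    have hrp : r ∣ p := by
      have h2 : r ∣ 2 * (w * w) := (hrw.mul_left w).mul_left 2
      rcases hM with h | h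
      · rw [← h]; exact Nat.dvd_add h2 hrM
      · have h3 : r ∣ p + M := by rw [h]; exact h2
        exact (Nat.dvd_add_left hrM).mp h3
    have : r = p := (Nat.prime_dvd_prime_iff_eq hr hp).mp hrp
    subst this
    exact absurd (Nat.le_of_dvd hw0 hrw) (not_le.mpr hwp)
  have hgcd : (w : ℤ).gcd r = 1 := by
    rw [Int.gcd_natCast_natCast]
    exact Nat.coprime_comm.mp ((Nat.Prime.coprime_iff_not_dvd hr).mpr hrw)
  have hsq : jacobiSym ((w : ℤ) ^ 2) r = 1 := jacobiSym.sq_one' hgcd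
  have h2 : jacobiSym 2 r = -1 := jacobiSym_two_eq_neg_one hr8
  have hmod : (p : ℤ) % (r : ℤ) = (2 * (w : ℤ) ^ 2) % (r : ℤ) := by
    rw [Int.emod_eq_emod_iff_emod_sub_eq_zero]
    rcases hM with h | h
    · have : (p : ℤ) - 2 * (w : ℤ) ^ 2 = ((M : ℕ) : ℤ) := by rw [← h]; push_cast; ring
      rw [this]
      exact Int.emod_eq_zero_of_dvd (Int.natCast_dvd_natCast.mpr hrM)
    · have : (p : ℤ) - 2 * (w : ℤ) ^ 2 = -((M : ℕ) : ℤ) := by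
        have h' : ((p + M : ℕ) : ℤ) = ((2 * (w * w) : ℕ) : ℤ) := by rw [h]
        push_cast at h'
        linear_combination h'
      rw [this]
      exact Int.emod_eq_zero_of_dvd ((dvd_neg).mpr (Int.natCast_dvd_natCast.mpr hrM))
  have hpr : jacobiSym (p : ℤ) r = -1 := by
    rw [jacobiSym.mod_left' hmod, jacobiSym.mul_left, h2, hsq]
    norm_num
  rw [jacobiSym.quadratic_reciprocity_one_mod_four' (Nat.odd_iff.mpr (by omega)) hp4, hpr]

/-- ★ **THE ROUNDING NON-RESIDUE on `p ≡ 5 (mod 8)`.** For every prime `p ≡ 5 (mod 8)`, `p ≥ 13`, there is a prime `r ≡ 3` or `5 (mod 8)`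
with `(r/p) = −1` and `r ≤ 4⌊√(p/2)⌋ + 3`: a `±3`-factor of the smaller of `M⁻ = p − 2w²`, `M⁺ = 2(w+2)² − p` at the even neighbours
`w < √(p/2) < w + 2` (`M⁻ ≡ 5`, `M⁺ ≡ 3 (mod 8)`, `M⁺ + M⁻ = 8w + 8`). When `r ≡ 5 (mod 8)` it is a `(5,−)`-partner in the window of §2
(`r² ≤ 9p` once `p ≥ 400`). [folklore] -/
theorem roundingNonresidue {p : ℕ} (hp : p.Prime) (hp8 : p % 8 = 5) (h13 : 13 ≤ p) :
    ∃ r : ℕ, r.Prime ∧ r ≤ 4 * Nat.sqrt (p / 2) + 3 ∧ (r % 8 = 3 ∨ r % 8 = 5) ∧ jacobiSym (r : ℤ) p = -1 := by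
  obtain ⟨X, hX⟩ : ∃ X, X = p / 2 := ⟨_, rfl⟩
  obtain ⟨s, hs⟩ : ∃ s, s = Nat.sqrt X := ⟨_, rfl⟩
  have hs1 : s * s ≤ X := hs ▸ Nat.sqrt_le X
  have hs2 : X < (s + 1) * (s + 1) := hs ▸ Nat.lt_succ_sqrt X
  have hpX : p = 2 * X + 1 := by omega
  have hs3 : 2 ≤ s := by
    by_contra h
    have : (s + 1) * (s + 1) ≤ 2 * 2 := Nat.mul_le_mul (by omega) (by omega)
    omega
  -- the even neighbour below `√X`
  obtain ⟨w, hw2, hws, hsw⟩ : ∃ w : ℕ, w % 2 = 0 ∧ w ≤ s ∧ s ≤ w + 1 := by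
    by_cases heven : s % 2 = 0
    · exact ⟨s, heven, le_rfl, by omega⟩
    · exact ⟨s - 1, by omega, by omega, by omega⟩
  have hw1 : 1 ≤ w := by omega
  have hww : 2 * (w * w) < p := by nlinarith [Nat.mul_le_mul hws hws]
  have hww2 : p < 2 * ((w + 2) * (w + 2)) := by nlinarith [Nat.mul_le_mul (show s + 1 ≤ w + 2 by omega) (show s + 1 ≤ w + 2 by omega)]
  obtain ⟨Mm, hMm⟩ : ∃ Mm : ℕ, 2 * (w * w) + Mm = p := ⟨p - 2 * (w * w), by omega⟩
  obtain ⟨Mp, hMp⟩ : ∃ Mp : ℕ, p + Mp = 2 * ((w + 2) * (w + 2)) := ⟨2 * ((w + 2) * (w + 2)) - p, by omega⟩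
  -- residues: `w` even ⇒ `2w² ≡ 0 (mod 8)`, `2(w+2)² ≡ 0 (mod 8)`
  obtain ⟨k, hk⟩ : ∃ k, w = 2 * k := ⟨w / 2, by omega⟩
  have h8a : 2 * (w * w) % 8 = 0 := by rw [hk, show 2 * (2 * k * (2 * k)) = 8 * (k * k) by ring]; simp
  have h8b : 2 * ((w + 2) * (w + 2)) % 8 = 0 := by
    rw [hk, show 2 * ((2 * k + 2) * (2 * k + 2)) = 8 * ((k + 1) * (k + 1)) by ring]; simp
  have hMm8 : Mm % 8 = 5 := by omega
  have hMp8 : Mp % 8 = 3 := by omega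
  have hMm0 : 0 < Mm := by omega
  have hMp0 : 0 < Mp := by omega
  have hsum : Mm + Mp = 8 * w + 8 := by nlinarith
  have hwp : w + 2 < p := by
    by_contra h
    have h1 : (p - 2) * (p - 2) ≤ s * s := Nat.mul_self_le_mul_self (by omega)
    have h2 : 11 * (p - 2) ≤ (p - 2) * (p - 2) := Nat.mul_le_mul_right _ (by omega)
    omega
  rw [← hX, ← hs]
  by_cases hle : Mm ≤ Mp
  · obtain ⟨r, hr, hrM, hr8⟩ := exists_prime_dvd_mod_eight_three_or_five (n := Mm) (Or.inr hMm8)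
    have hrle : r ≤ Mm := Nat.le_of_dvd hMm0 hrM
    have hro : r % 2 = 1 := by omega
    exact ⟨r, hr, by omega, hr8,
      jacobiSym_eq_neg_one_of_dvd_sub_two_mul_sq hp (by omega) hr hr8 (Or.inl hMm) hrM (by omega) (by omega)⟩
  · obtain ⟨r, hr, hrM, hr8⟩ := exists_prime_dvd_mod_eight_three_or_five (n := Mp) (Or.inl hMp8)
    have hrle : r ≤ Mp := Nat.le_of_dvd hMp0 hrM
    have hro : r % 2 = 1 := by omega
    exact ⟨r, hr, by omega, hr8,
      jacobiSym_eq_neg_one_of_dvd_sub_two_mul_sq (w := w + 2) hp (by omega) hr hr8 (Or.inr hMp) hrM (by omega) hwp⟩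

/-- The rounding non-residue lies in the window: `(4⌊√(p/2)⌋ + 3)² ≤ 9p` for `p ≥ 400`. [folklore] -/
theorem sq_roundingBound_le {p : ℕ} (h400 : 400 ≤ p) :
    (4 * Nat.sqrt (p / 2) + 3) * (4 * Nat.sqrt (p / 2) + 3) ≤ 9 * p := by
  obtain ⟨s, hs⟩ : ∃ s, s = Nat.sqrt (p / 2) := ⟨_, rfl⟩
  have hs1 : s * s ≤ p / 2 := hs ▸ Nat.sqrt_le (p / 2)
  have hX : 2 * (p / 2) ≤ p := Nat.mul_div_le p 2
  rw [← hs]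
  have hs14 : 14 ≤ s := by
    by_contra h
    have : (p / 2) < (s + 1) * (s + 1) := hs ▸ Nat.lt_succ_sqrt (p / 2)
    have : (s + 1) * (s + 1) ≤ 14 * 14 := Nat.mul_le_mul (by omega) (by omega)
    omega
  have h14 : 14 * s ≤ s * s := Nat.mul_le_mul_right s hs14
  nlinarith

/-- ★ **Corner for `B_p` from a rounding non-residue of type `5`**: for every prime `p ≡ 5 (mod 8)`, `p ≥ 2700`, if SOME prime `q₀ ≡ 5 (mod 8)`
with `(q₀/p) = −1` satisfies `q₀ ≤ 4⌊√(p/2)⌋ + 3` (e.g. the rounding prime of `roundingNonresidue` when it is `≡ 5 (mod 8)`), the crux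
conclusion holds for `W = B_p` — modulo Burungale–Tian + Deuring–Hecke. [cite: BurungaleTian2026, Thm. 1.1] [cite: Oesterle1988Gauss, II §3 Proposition p. 57 (27)] -/
theorem cruxOnBpCorner_of_small_five_partner (hBT : burungaleTian_analyticRank_eq_zero_of_selmerCorank_eq_zero_of_hasCM)
    (hH : hasEntireLFunction_of_j_mem_maximalCMJInvariants) :
    ∀ (p : ℕ) [Fact p.Prime] [(⟨0, 4 * (p : ℚ), 0, 2 * (p : ℚ) ^ 2, 0⟩ : WeierstrassCurve ℚ).IsElliptic]
      [(⟨0, 4 * (p : ℚ), 0, 2 * (p : ℚ) ^ 2, 0⟩ : WeierstrassCurve ℚ).IsGloballyMinimal]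
      [NeZero ((⟨0, 4 * (p : ℚ), 0, 2 * (p : ℚ) ^ 2, 0⟩ : WeierstrassCurve ℚ).conductorNorm ℤ)],
      p % 8 = 5 → 2700 ≤ p →
      (∃ q₀ : ℕ, q₀.Prime ∧ q₀ % 8 = 5 ∧ jacobiSym (q₀ : ℤ) p = -1 ∧ q₀ ≤ 4 * Nat.sqrt (p / 2) + 3) →
      ∃ (K : Type) (_ : Field K) (_ : NumberField K),
        IsImaginaryQuadratic K ∧ 4 < (NumberField.discr K).natAbs ∧
        SatisfiesHeegnerHypothesis ((⟨0, 4 * (p : ℚ), 0, 2 * (p : ℚ) ^ 2, 0⟩ : WeierstrassCurve ℚ).conductorNorm ℤ) K ∧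
        ((⟨0, 4 * (p : ℚ), 0, 2 * (p : ℚ) ^ 2, 0⟩ : WeierstrassCurve ℚ).quadraticTwist (NumberField.discr K : ℚ)).entireLFunction 1 ≠ 0 ∧
        NumberField.classNumber K < p ∧ ¬ p ∣ NumberField.classNumber K := by
  intro p hpF _ _ _ hp8 hp2700 ⟨q₀, hq₀, hq₀8, hJq, hle⟩
  have hwin : q₀ * q₀ ≤ 9 * p := (Nat.mul_le_mul hle hle).trans (sq_roundingBound_le (by omega : 400 ≤ p))
  exact cruxOnBpCornerWindow_of_two_facts hBT hH p hp8 hp2700 q₀ hq₀ hq₀8 hJq hwin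

end Summit.BirchSwinnertonDyer.BirchSwinnertonDyer.Theorems.BiquadraticEisensteinDescentHeegnerTwistCouplingInSupplySqrtTwoWindow

end
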